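import Summits.BirchSwinnertonDyer.Rank1Residual.Additive.X4SharpUnitFreeResidue
import Summits.BirchSwinnertonDyer.Rank1Residual.Additive.GordRankZeroKatoComponentTower
import HarnessLib

/-!
# X4♯(unit-free) REDUCED TO ITS RESIDUES — sharpest form of gen 14: the (G-ord, `e = 2`) rows leave
# the TAM-DEFECT₂ / ODD-SHA / MANIN pieces (cell `b2b-bsdres`, seat additive-p4, lines V22–V24;
# sequel of `Additive/X4SharpUnitFreeResidue.lean`)

HONEST FRAMING (cell `b2b-bsdres`, run/shared/lean/b2b/bsd-rank1-residual/, verbatim in every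
file): the goal of the cell is to DELETE the COMBINATION-SHAPED residual classes of the
Birch–Swinnerton-Dyer formula for ALL analytic-rank `≤ 1` elliptic curves over `ℚ` — "full BSD
formula for every rank `≤ 1` curve in class `C`" assembled STRICTLY from published theorems — so
that the rank-`≤ 1` remainder becomes exactly the CONSTRUCTION-SHAPED classes, which are TYPED
(missing-input `Prop`s), NOT attempted. This is not "finishing BSD". Sub-cell additive-p4 (X3♯/X4♯
direct): research route on the CONSTRUCTION-SHAPED class X4; no claim beyond the stated classes;
the label X4 is UNCHANGED by this file; nothing is booked. Theorems only (no definition, no named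
fact minted; every published input is an explicit named-fact hypothesis of the tree).

## What this file proves

`x4SharpUnitFree_iff_lower_and_residues_of_casselsTate` (V22 part 2, §3b) says: granted the sharp
Kato reading (A161), Delbourgo Prop. 4, modular parametrisation data, Wuthrich L. 20, Kato's
half-eigen divisibility over `ℚ(μ_{p^∞})`, Cassels–Tate, GZK and modularity,
`X4SharpUnitFree ⟺ LOWER ∧ EXOTIC ∧ TAM-DEFECT₂ ∧ ODD-SHA ∧ MANIN`. On the potentially good
ORDINARY rows with `e = 2` (Kodaira `I₀*`, ordinary twist: `TypeGOrd W p ∧ semistabilityIndex W p = 2`)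
seat additive-p2's `ω^{(p−1)/2}`-branch route (`Kato2004.charIdeal_dvd_padicLFunctionBranch_component_of_surjective`,
`hK`) gives the upper half with NO Tamagawa and NO Manin hypothesis — at `p = 3` from a tower
certificate (`ClassX4Gord.missingUpperBoundAt_rankZero_of_katoComponent_of_towerSurj`, line V24) —
so those rows LEAVE the three upper-residue pieces:

* **`x4SharpUnitFree_iff_lower_and_residues_sharp`**: with `hK` as a seventh named fact,
  `X4SharpUnitFree ⟺ LOWER ∧ EXOTIC ∧ TAM-DEFECT₂♭ ∧ ODD-SHA♭ ∧ MANIN♭`, where `♭` = restricted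
  to the potentially good rows that are NOT (G-ord with `e = 2`). A (G-ord, `e = 2`) row without a
  tower is an EXOTIC row (`p = 3` by Serre), already listed.

Census (seat, HOME/b2b-bsdres-additive-p4/V24-*.txt; window N < 2·10⁴ ‖ 10⁴, X4 ∧ `r_an = 0`, all
odd `p`, 4 539 ‖ 1 232 pairs): after V22–V24 the kernel covers (BSD_p modulo the seven facts + the
`p = 3` census certificates) 4 403 ‖ 1 184 pairs; residue LOWER 85 ‖ 25, TAM-DEFECT₂♭ 8 ‖ 1
(9702br1, 10260c1, 16650bo1, 17514p1, 17955l1, 19530cb1 at `3`; 15050bb1 at `5`; 18150da1 at `11`),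
ODD-SHA♭ 0, MANIN♭ 0, EXOTIC 1 (cert-closed), NON-SURJ 43 ‖ 22. X4 stays CONSTRUCTION-SHAPED;
nothing booked.

References: Kato 2004 [Kato2004Asterisque] Thm. 14.5 (3), Thm. 17.4 (3); Delbourgo 1998 [Delbourgo1998]
Prop. 4; Wuthrich 2014 [Wuthrich2014] Lemma 20, Cor. 19; Cassels 1962 / Silverman *AEC* X.4.14
[SilvermanAEC2009]; Kim 2026 [Kim2022StructureSelmer] Conj. 1.10; Miller 2011 [Miller2011LMS] Def. 1.1.
-/

noncomputable section

open scoped Classical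

open WeierstrassCurve Literature.NumberTheory.EllipticCurves
  Literature.NumberTheory.EllipticCurves.ModularForms
  Literature.NumberTheory.EllipticCurves.Rank1Residual
  Literature.NumberTheory.EllipticCurves.Rank1Residual.Typed

namespace Summit.BirchSwinnertonDyer.Rank1Residual.Additive

/-- **The (G-ord, `e = 2`) rows need no upper-residue hypothesis**: on X4 ∧ `r_an = 0` ∧ surj(p) ∧
pot-good ∧ `TypeGOrd W p` ∧ `e = 2`, the upper half holds from `hK` + `hDel` + `hmodD` + GZK +
modularity, the tower being automatic at `p ≠ 3` (Serre) and an EXOTIC-row matter at `p = 3`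
(hypothesis `hexotic`). [cite: Kato2004Asterisque, Thm. 17.4 (3) (p. 273)] [cite: Delbourgo1998, Prop. 4 (p. 144)]
[cite: Serre1972, IV §3.4] -/
theorem ClassX4Gord.missingUpperBoundAt_rankZero_of_katoComponent_of_exotic
    {W : WeierstrassCurve ℚ} [W.IsElliptic] [W.IsGloballyMinimal] {p : ℕ} [hp : Fact p.Prime]
    (hK : Kato2004.charIdeal_dvd_padicLFunctionBranch_component_of_surjective)
    (hDel : Delbourgo1998.prop4_rankZero_pow_dvd_constantCoeff)
    (hGZK : rank_eq_analyticRank_of_analyticRank_le_one) (hmod : hasEntireLFunction_rat)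
    (hmodD : nonempty_modularParametrizationData)
    (hexotic : ∀ (W : WeierstrassCurve ℚ) [W.IsElliptic] [W.IsGloballyMinimal],
      W.analyticRank = 0 → ClassX4 W 3 → Surj W 3 → 0 ≤ padicValRat 3 W.j →
      ¬ (∀ n : ℕ, W.HasSurjectiveModNGaloisRep (3 ^ n : ℕ)) → MissingUpperBoundAt W 3)
    (hr : W.analyticRank = 0) (hX : ClassX4 W p) (hs : Surj W p) (hj : 0 ≤ padicValRat p W.j)
    (hG : TypeGOrd W p ∧ semistabilityIndex W p = 2) : MissingUpperBoundAt W p := by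
  by_cases htower : ∀ n : ℕ, W.HasSurjectiveModNGaloisRep (p ^ n : ℕ)
  · exact ClassX4Gord.missingUpperBoundAt_rankZero_of_katoComponent_of_towerSurj hK hDel hGZK hmod
      hmodD ⟨hX, hG.1⟩ hG.2 hr htower
  · rcases eq_three_or_five_le_of_classX4 W p hX with h3 | h5
    · subst h3
      exact hexotic W hr hX hs hj htower
    · exact absurd (serre_hasSurjectiveModNGaloisRep_pow_holds W p h5 hs) htower

/-- **X4♯(unit-free) ⟺ LOWER ∧ EXOTIC ∧ TAM-DEFECT₂♭ ∧ ODD-SHA♭ ∧ MANIN♭** (granted SEVEN named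
facts — sharp Kato `hKatoS`; Delbourgo Prop. 4 `hDel`; `hmodD`; Wuthrich L. 20 `hL20`; Kato half-eigen
`hKatoχ`; Kato component `hK`; Cassels–Tate `hCT` — + GZK + modularity): the upper-residue pieces
TAM-DEFECT₂ (`ord_p ∏ c_ℓ ≥ v_p(c_p) + 2`), ODD-SHA (`ord_p #Ш_an` odd) and MANIN (no datum with
`p ∤ c_D`) of `x4SharpUnitFree_iff_lower_and_residues_of_casselsTate` RESTRICTED (`♭`) to the rows
that are NOT potentially good ordinary with `e = 2` — on those additive-p2's `ω^{(p−1)/2}`-branch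
route gives the upper half unconditionally in `∏ c_ℓ` and the Manin constant
(`ClassX4Gord.missingUpperBoundAt_rankZero_of_katoComponent_of_exotic`). The sharpest kernel form
of the end-state of X4♯(unit-free) in this cell. [cite: Kato2004Asterisque, Thm. 14.5 (3) (p. 236), Thm. 17.4 (3) (p. 273)]
[cite: Delbourgo1998, Prop. 4 (p. 144)] [cite: Wuthrich2014, Lemma 20 (p. 399), Cor. 19 (p. 398)]
[cite: SilvermanAEC2009, Thm. X.4.14] [cite: Kim2022StructureSelmer, Conj. 1.10 (PDF p. 8)]
[cite: Miller2011LMS, Def. 1.1] -/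
theorem x4SharpUnitFree_iff_lower_and_residues_sharp
    (hCT : exists_casselsTate_pairing (K := ℚ))
    (hKatoS : Kato2004.rankZero_padicValNat_sha_le_sub_localTamagawa_of_additive_potGood_of_imageContainsSL2)
    (hDel : Delbourgo1998.prop4_rankZero_pow_dvd_constantCoeff)
    (hGZK : rank_eq_analyticRank_of_analyticRank_le_one) (hmod : hasEntireLFunction_rat)
    (hmodD : nonempty_modularParametrizationData)
    (hL20 : Wuthrich2014.lemma20_surjective_threeAdic_of_semistable)
    (hKatoχ : Wuthrich2014.kato_halfEigenCharIdeal_dvd_cyclotomicPrime_of_surjective)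
    (hK : Kato2004.charIdeal_dvd_padicLFunctionBranch_component_of_surjective) :
    X4SharpUnitFree ↔
      (∀ (W : WeierstrassCurve ℚ) [W.IsElliptic] [W.IsGloballyMinimal] (p : ℕ) [Fact p.Prime],
          W.analyticRank = 0 → ClassX4 W p → Surj W p → MissingLowerBoundAt W p) ∧
      (∀ (W : WeierstrassCurve ℚ) [W.IsElliptic] [W.IsGloballyMinimal],
          W.analyticRank = 0 → ClassX4 W 3 → Surj W 3 → 0 ≤ padicValRat 3 W.j →
          ¬ (∀ n : ℕ, W.HasSurjectiveModNGaloisRep (3 ^ n : ℕ)) → MissingUpperBoundAt W 3) ∧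
      (∀ (W : WeierstrassCurve ℚ) [W.IsElliptic] [W.IsGloballyMinimal] (p : ℕ) [Fact p.Prime],
          W.analyticRank = 0 → ClassX4 W p → Surj W p → 0 ≤ padicValRat p W.j →
          ¬ (TypeGOrd W p ∧ semistabilityIndex W p = 2) →
          padicValNat p ((W.baseChange ℚ_[p]).localTamagawaNumber ℤ_[p]) + 2 ≤
            padicValNat p W.tamagawaProduct →
          MissingUpperBoundAt W p) ∧
      (∀ (W : WeierstrassCurve ℚ) [W.IsElliptic] [W.IsGloballyMinimal] (p : ℕ) [Fact p.Prime],
          W.analyticRank = 0 → ClassX4 W p → Surj W p → 0 ≤ padicValRat p W.j →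
          ¬ (TypeGOrd W p ∧ semistabilityIndex W p = 2) →
          (∃ q : ℚ, shaAn W = (q : ℂ) ∧ Odd (padicValRat p q)) → MissingUpperBoundAt W p) ∧
      (∀ (W : WeierstrassCurve ℚ) [W.IsElliptic] [W.IsGloballyMinimal] (p : ℕ) [Fact p.Prime],
          W.analyticRank = 0 → ClassX4 W p → Surj W p → 0 ≤ padicValRat p W.j →
          ¬ (TypeGOrd W p ∧ semistabilityIndex W p = 2) →
          (∀ (N : ℕ) [NeZero N] (D : ModularParametrizationData W N), (p : ℤ) ∣ D.maninConstant) →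
          MissingUpperBoundAt W p) := by
  rw [x4SharpUnitFree_iff_lower_and_residues_of_casselsTate hCT hKatoS hDel hGZK hmod hmodD hL20 hKatoχ]
  refine and_congr_right fun _ ↦ and_congr_right fun hexotic ↦ ?_
  constructor
  · rintro ⟨htam, hodd, hmanin⟩
    exact ⟨fun V _ _ p _ hr hX hs hj _ h2 ↦ htam V p hr hX hs hj h2,
      fun V _ _ p _ hr hX hs hj _ ho ↦ hodd V p hr hX hs hj ho,
      fun V _ _ p _ hr hX hs hj _ hD ↦ hmanin V p hr hX hs hj hD⟩
  · rintro ⟨htam, hodd, hmanin⟩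
    refine ⟨fun V _ _ p _ hr hX hs hj h2 ↦ ?_, fun V _ _ p _ hr hX hs hj ho ↦ ?_,
      fun V _ _ p _ hr hX hs hj hD ↦ ?_⟩
    · by_cases hG : TypeGOrd V p ∧ semistabilityIndex V p = 2
      · exact ClassX4Gord.missingUpperBoundAt_rankZero_of_katoComponent_of_exotic hK hDel hGZK hmod
          hmodD hexotic hr hX hs hj hG
      · exact htam V p hr hX hs hj hG h2
    · by_cases hG : TypeGOrd V p ∧ semistabilityIndex V p = 2
      · exact ClassX4Gord.missingUpperBoundAt_rankZero_of_katoComponent_of_exotic hK hDel hGZK hmod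
          hmodD hexotic hr hX hs hj hG
      · exact hodd V p hr hX hs hj hG ho
    · by_cases hG : TypeGOrd V p ∧ semistabilityIndex V p = 2
      · exact ClassX4Gord.missingUpperBoundAt_rankZero_of_katoComponent_of_exotic hK hDel hGZK hmod
          hmodD hexotic hr hX hs hj hG
      · exact hmanin V p hr hX hs hj hG hD

end Summit.BirchSwinnertonDyer.Rank1Residual.Additive

end
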